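import Summits.Parity.GeneralizedHardyLittlewood.Theorems.RomanoffHeathBrownSecondMomentTools
import Literature.NumberTheory.Sieve.CubicFormClassCountBounds
import Literature.NumberTheory.Sieve.CubicBoxModelDispersion
import Literature.NumberTheory.Sieve.PintzRuzsa2003SingularSums
import HarnessLib

/-!
# Route `RomanoffHeathBrown` — shared tools for the class-energy cruxes (stmt-Parity-20272 / 20273)

Helper file (`--supports stmt-Parity-20272`) for the two class-energy items `SmallModuliCorrelation`,
`LargeModuliCorrelation` of `Summits/Parity/GeneralizedHardyLittlewood/Theses/RomanoffHeathBrown.lean`.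
Notation: `u = hbWeight c N`, `U = ∑_{k ≤ N} u(k)`, `U_d(r) = ∑_{k ≤ N, k ≡ r (d)} u(k)`,
`g(d) = ∏_{p ∣ d} 1/(p − 2)`, `X = hbX N = (N/6)^{1/3}`, `η = hbEta c N = (log X)^{−c}`,
`S = hbSide c N = ⌊X(1+η)⌋ − ⌊X⌋`.

Contents (all elementary):
* `sum_range_classSum_eq`, `classEnergy_le` — the classes mod `d` partition `[1, N]`, so
  `∑_{r<d} U_d(r)² ≤ (sup_r U_d(r)) · U` (the ℓ²-to-sup step of both cruxes);
* `sum_prod_primeFactors_le_sum / _le_tail` — sums of `∏_{p∣d} f(p)` over square-free `d` against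
  sub-sums of `∏_p (1 + f(p))`, here its Rankin tail (reindex `d ↦ primeFactors d`; the full product is
  the tree's `PintzRuzsa2003.sum_prod_primeFactors_le_prod_one_add`);
* `singWeight_le`, `singWeight_mul_pow_div`, `pow_card_div_pow_eq_prod` — arithmetic of `g(d)` on odd
  square-free `d` (`g(d) ≤ 3^{ω(d)}/d`; `g(d) ≥ 0` is the sibling file's
  `prod_primeFactors_inv_sub_two_nonneg`, `Theorems/RomanoffHeathBrownSecondMomentTools.lean`);
* the regime of large `N`: `rpow_third_eq` (`N^{1/3} = 6^{1/3} X`), `log_le_four_mul_log_hbX`,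
  `hbEta_mul_hbX_sub_one_le_hbSide` (`S ≥ ηX − 1`), `eventually_sqrt_hbX_le` (`√X ≤ ηX`) and the
  conjunction `eventually_regime`.

References: Nathanson, *Additive Number Theory: The Classical Bases* (1996) §7.6 [Nathanson1996];
Halberstam–Richert, *Sieve Methods* (1974) Ch. 2 §2 [HalberstamRichert1974];
Heath-Brown, Acta Math. 186 (2001) [HeathBrownActa2001].
-/

noncomputable section

open Finset Filter Topology Asymptotics
open Literature.NumberTheory.Sieve Literature.NumberTheory.Sieve.CubicPrimes
open Literature.NumberTheory.Sieve.CubicMinorant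
open Summit.Parity.GeneralizedHardyLittlewood.Theses.RomanoffHeathBrown

namespace Summit.Parity.GeneralizedHardyLittlewood.Theorems.RomanoffHeathBrown

/-! ### The classes mod `d` partition the mass -/

/-- `∑_{r < d} U_d(r) = U`: the residue classes mod `d ≥ 1` partition `{1, …, N}`. [this line] -/
theorem sum_range_classSum_eq (c : ℝ) (N : ℕ) {d : ℕ} (hd : 0 < d) :
    ∑ r ∈ range d, ∑ k ∈ (Icc 1 N).filter (fun k : ℕ => k ≡ r [MOD d]), hbWeight c N k =
      ∑ k ∈ Icc 1 N, hbWeight c N k := by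
  rw [← sum_fiberwise_of_maps_to (fun k (_ : k ∈ Icc 1 N) => mem_range.mpr (Nat.mod_lt k hd))
    (hbWeight c N)]
  refine sum_congr rfl fun r hr => sum_congr ?_ fun _ _ => rfl
  ext k
  simp only [mem_filter, Nat.ModEq, Nat.mod_eq_of_lt (mem_range.mp hr)]

/-- **ℓ² to sup**: if every class sum is `≤ B` then `∑_{r<d} U_d(r)² ≤ B · U`. [this line] -/
theorem classEnergy_le (c : ℝ) (N : ℕ) {d : ℕ} (hd : 0 < d) {B : ℝ}
    (hB : ∀ r ∈ range d, ∑ k ∈ (Icc 1 N).filter (fun k : ℕ => k ≡ r [MOD d]), hbWeight c N k ≤ B) :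
    ∑ r ∈ range d, (∑ k ∈ (Icc 1 N).filter (fun k : ℕ => k ≡ r [MOD d]), hbWeight c N k) ^ 2 ≤
      B * ∑ k ∈ Icc 1 N, hbWeight c N k := by
  rw [← sum_range_classSum_eq c N hd, mul_sum]
  refine sum_le_sum fun r hr => ?_
  have h0 : 0 ≤ ∑ k ∈ (Icc 1 N).filter (fun k : ℕ => k ≡ r [MOD d]), hbWeight c N k :=
    sum_nonneg fun k _ => hbWeight_nonneg c N k
  rw [sq]
  exact mul_le_mul_of_nonneg_right (hB r hr) h0

/-! ### Sums over square-free moduli against Euler products -/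

/-- Reindexing a sum over square-free `d` by `t = primeFactors d` (injective since `d = ∏ t`):
`∑_{d ∈ S} ∏_{p∣d} f(p) ≤ ∑_{t ∈ T} ∏_{p∈t} f(p)` whenever every `primeFactors d`, `d ∈ S`, lies in `T`
and the products over `T` are nonnegative. [this line] -/
theorem sum_prod_primeFactors_le_sum {S : Finset ℕ} {T : Finset (Finset ℕ)} (f : ℕ → ℝ)
    (hT : ∀ t ∈ T, 0 ≤ ∏ p ∈ t, f p) (hS : ∀ d ∈ S, Squarefree d ∧ d.primeFactors ∈ T) :
    ∑ d ∈ S, ∏ p ∈ d.primeFactors, f p ≤ ∑ t ∈ T, ∏ p ∈ t, f p := by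
  classical
  have hinj : Set.InjOn Nat.primeFactors (S : Set ℕ) := by
    intro d₁ h₁ d₂ h₂ heq
    have e₁ := Nat.prod_primeFactors_of_squarefree (hS d₁ h₁).1
    have e₂ := Nat.prod_primeFactors_of_squarefree (hS d₂ h₂).1
    rw [← e₁, ← e₂]
    exact congrArg (fun t : Finset ℕ => ∏ p ∈ t, p) heq
  calc ∑ d ∈ S, ∏ p ∈ d.primeFactors, f p
      = ∑ t ∈ S.image Nat.primeFactors, ∏ p ∈ t, f p := by rw [sum_image hinj]
    _ ≤ ∑ t ∈ T, ∏ p ∈ t, f p :=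
        sum_le_sum_of_subset_of_nonneg (fun t ht => by
          obtain ⟨d, hd, rfl⟩ := mem_image.mp ht
          exact (hS d hd).2) fun t ht _ => hT t ht

/-- **The Rankin tail**: `∑_{d ∈ S} ∏_{p∣d} f(p) ≤ ∑_{t ⊆ P, ∏t > Q} ∏_{p∈t} f(p)` for `f ≥ 0` on `P`,
when every `d ∈ S` is square-free, `> Q`, with prime factors in `P`.
[cite: HalberstamRichert1974, Ch. 2 §2 (2.3)–(2.4) (Rankin's trick for sums over square-free d)] -/
theorem sum_prod_primeFactors_le_tail {S P : Finset ℕ} (f : ℕ → ℝ) (hf : ∀ p ∈ P, 0 ≤ f p) {Q : ℝ}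
    (hS : ∀ d ∈ S, Squarefree d ∧ d.primeFactors ⊆ P ∧ Q < (d : ℝ)) :
    ∑ d ∈ S, ∏ p ∈ d.primeFactors, f p ≤
      ∑ t ∈ P.powerset with Q < ∏ p ∈ t, ((p : ℕ) : ℝ), ∏ p ∈ t, f p := by
  classical
  refine sum_prod_primeFactors_le_sum f (fun t ht => ?_) fun d hd => ?_
  · have ht' := mem_powerset.mp (mem_filter.mp ht).1
    exact prod_nonneg fun p hp => hf p (ht' hp)
  · obtain ⟨hsq, hP, hQ⟩ := hS d hd
    refine ⟨hsq, mem_filter.mpr ⟨mem_powerset.mpr hP, ?_⟩⟩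
    rw [← Nat.cast_prod, Nat.prod_primeFactors_of_squarefree hsq]
    exact hQ

/-! ### The singular weight `g(d) = ∏_{p∣d} 1/(p−2)` on odd square-free `d` -/

/-- The prime factors of an odd number are `≥ 3`. [folklore] -/
theorem three_le_of_mem_primeFactors_of_odd {d p : ℕ} (hd : Odd d) (hp : p ∈ d.primeFactors) :
    3 ≤ p := by
  have hpp := Nat.prime_of_mem_primeFactors hp
  have hpd := Nat.dvd_of_mem_primeFactors hp
  rcases hpp.eq_two_or_odd' with h2 | hodd
  · subst h2
    exact absurd (hd.of_dvd_nat hpd) (by decide)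
  · have := hpp.two_le
    rcases hodd with ⟨k, hk⟩
    omega

/-- `a^{ω(d)}/d^k = ∏_{p∣d} a/p^k` for square-free `d`. [this line] -/
theorem pow_card_div_pow_eq_prod {d : ℕ} (hsq : Squarefree d) (a : ℝ) (k : ℕ) :
    a ^ #d.primeFactors / (d : ℝ) ^ k = ∏ p ∈ d.primeFactors, a / (p : ℝ) ^ k := by
  have hd : (d : ℝ) = ∏ p ∈ d.primeFactors, (p : ℝ) := by
    rw [← Nat.cast_prod, Nat.prod_primeFactors_of_squarefree hsq]
  rw [hd, ← prod_pow, ← prod_const, prod_div_distrib]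

/-- `g(d) · a^{ω(d)}/d = ∏_{p∣d} a/((p−2)p)` for square-free `d`. [this line] -/
theorem singWeight_mul_pow_div {d : ℕ} (hsq : Squarefree d) (a : ℝ) :
    (∏ p ∈ d.primeFactors, (1 : ℝ) / ((p : ℝ) - 2)) * (a ^ #d.primeFactors / d) =
      ∏ p ∈ d.primeFactors, a / (((p : ℝ) - 2) * p) := by
  have h := pow_card_div_pow_eq_prod hsq a 1
  rw [pow_one] at h
  rw [h, ← prod_mul_distrib]
  refine prod_congr rfl fun p _ => ?_
  rw [pow_one, div_mul_div_comm, one_mul]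

/-- `g(d) ≤ 3^{ω(d)}/d` for odd square-free `d` (`1/(p−2) ≤ 3/p` for `p ≥ 3`). [this line] -/
theorem singWeight_le {d : ℕ} (hsq : Squarefree d) (hd : Odd d) :
    ∏ p ∈ d.primeFactors, (1 : ℝ) / ((p : ℝ) - 2) ≤ (3 : ℝ) ^ #d.primeFactors / d := by
  have h := pow_card_div_pow_eq_prod hsq 3 1
  rw [pow_one] at h
  rw [h]
  refine prod_le_prod (fun p hp => ?_) fun p hp => ?_
  · have h3 : (3 : ℝ) ≤ p := by exact_mod_cast three_le_of_mem_primeFactors_of_odd hd hp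
    exact div_nonneg zero_le_one (by linarith)
  · have h3 : (3 : ℝ) ≤ p := by exact_mod_cast three_le_of_mem_primeFactors_of_odd hd hp
    rw [pow_one, div_le_div_iff₀ (by linarith) (by linarith)]
    linarith

/-! ### The regime of large `N` -/

/-- `N^{1/3} = 6^{1/3} X` for `X = (N/6)^{1/3}`. [this line] -/
theorem rpow_third_eq (N : ℕ) : (N : ℝ) ^ ((1 : ℝ) / 3) = (6 : ℝ) ^ ((1 : ℝ) / 3) * hbX N := by
  unfold hbX
  rw [Real.div_rpow (Nat.cast_nonneg N) (by norm_num), mul_div_cancel₀]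
  exact (Real.rpow_pos_of_pos (by norm_num) _).ne'

/-- `N^{1/3} ≤ 2X` (`6^{1/3} ≤ 8^{1/3} = 2`). [this line] -/
theorem rpow_third_le_two_mul_hbX (N : ℕ) : (N : ℝ) ^ ((1 : ℝ) / 3) ≤ 2 * hbX N := by
  rw [rpow_third_eq]
  refine mul_le_mul_of_nonneg_right ?_ (hbX_nonneg N)
  have h8 : (8 : ℝ) = (2 : ℝ) ^ ((3 : ℕ) : ℝ) := by rw [Real.rpow_natCast]; norm_num
  calc (6 : ℝ) ^ ((1 : ℝ) / 3) ≤ (8 : ℝ) ^ ((1 : ℝ) / 3) :=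
        Real.rpow_le_rpow (by norm_num) (by norm_num) (by norm_num)
    _ = 2 := by rw [h8, ← Real.rpow_mul (by norm_num)]; norm_num

/-- `N = 6X³`. [this line] -/
theorem cast_eq_six_mul_hbX_pow (N : ℕ) : (N : ℝ) = 6 * hbX N ^ 3 := by
  rw [hbX_pow_three]; ring

/-- `log N ≤ 4 log X` once `X ≥ 6` (`N = 6X³`). [this line] -/
theorem log_le_four_mul_log_hbX {N : ℕ} (hX : 6 ≤ hbX N) :
    Real.log N ≤ 4 * Real.log (hbX N) := by
  have hX0 : 0 < hbX N := by linarith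
  rw [cast_eq_six_mul_hbX_pow N, Real.log_mul (by norm_num) (by positivity), Real.log_pow]
  have : Real.log 6 ≤ Real.log (hbX N) := Real.log_le_log (by norm_num) hX
  push_cast
  linarith

/-- `S ≥ ηX − 1` when `η ≥ 0` (`S = ⌊X(1+η)⌋ − ⌊X⌋`). [this line] -/
theorem hbEta_mul_hbX_sub_one_le_hbSide {c : ℝ} {N : ℕ} (hη : 0 ≤ hbEta c N) :
    hbEta c N * hbX N - 1 ≤ (hbSide c N : ℝ) := by
  have hX := hbX_nonneg N
  have hXη : hbX N * (1 + hbEta c N) = hbX N + hbEta c N * hbX N := by ring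
  have hY : hbX N ≤ hbX N * (1 + hbEta c N) := by rw [hXη]; nlinarith
  have hAM : ⌊hbX N⌋₊ ≤ ⌊hbX N * (1 + hbEta c N)⌋₊ := Nat.floor_le_floor hY
  rw [hbSide_def, Nat.cast_sub hAM]
  have h1 : hbX N * (1 + hbEta c N) - 1 < (⌊hbX N * (1 + hbEta c N)⌋₊ : ℝ) :=
    Nat.sub_one_lt_floor _
  have h2 : (⌊hbX N⌋₊ : ℝ) ≤ hbX N := Nat.floor_le hX
  linarith

/-- **`√X ≤ ηX` eventually** (`(log X)^c ≤ X^{1/2}` for large `X`).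
[cite: HeathBrownActa2001, Theorem 1 (the box X < x, y ≤ X(1+η) with η = (log X)^{-c})] -/
theorem eventually_sqrt_hbX_le (c : ℝ) :
    ∀ᶠ N : ℕ in atTop, Real.sqrt (hbX N) ≤ hbEta c N * hbX N := by
  have hlo : ∀ᶠ x : ℝ in atTop, ‖Real.log x ^ c‖ ≤ 1 * ‖x ^ (1 / 2 : ℝ)‖ :=
    (isLittleO_log_rpow_rpow_atTop c (by norm_num : (0 : ℝ) < 1 / 2)).bound one_pos
  have hev : ∀ᶠ x : ℝ in atTop, Real.sqrt x ≤ Real.log x ^ (-c) * x := by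
    filter_upwards [hlo, eventually_gt_atTop (1 : ℝ)] with x hx hx1
    have hlogpos : 0 < Real.log x := Real.log_pos hx1
    have hLc : 0 < Real.log x ^ c := Real.rpow_pos_of_pos hlogpos c
    have hx0 : 0 ≤ x := by linarith
    rw [one_mul, Real.norm_of_nonneg hLc.le, Real.norm_of_nonneg (Real.rpow_nonneg hx0 _),
      ← Real.sqrt_eq_rpow] at hx
    rw [Real.rpow_neg hlogpos.le, ← div_eq_inv_mul, le_div_iff₀ hLc]
    calc Real.sqrt x * Real.log x ^ c ≤ Real.sqrt x * Real.sqrt x :=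
          mul_le_mul_of_nonneg_left hx (Real.sqrt_nonneg x)
      _ = x := Real.mul_self_sqrt hx0
  filter_upwards [tendsto_hbX.eventually hev] with N hN
  simpa only [hbEta] using hN

/-- **The regime of large `N`** (for `c > 0` and any threshold `X₀`): eventually `N > 6`, `X ≥ X₀`,
`0 < η ≤ 1/10`, `√X ≤ ηX`, `ηX − 1 ≤ S ≤ 2ηX`, `S ≤ N/6` and `S ≥ 1`. [this line] -/
theorem eventually_regime {c : ℝ} (hc : 0 < c) (X₀ : ℝ) : ∀ᶠ N : ℕ in atTop,
    6 < N ∧ X₀ ≤ hbX N ∧ 0 < hbEta c N ∧ hbEta c N ≤ 1 / 10 ∧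
      Real.sqrt (hbX N) ≤ hbEta c N * hbX N ∧
      (hbSide c N : ℝ) ≤ 2 * (hbEta c N * hbX N) ∧
      hbEta c N * hbX N - 1 ≤ (hbSide c N : ℝ) ∧ (hbSide c N : ℝ) ≤ (N : ℝ) / 6 ∧
      1 ≤ hbSide c N := by
  filter_upwards [eventually_gt_atTop 6, tendsto_hbX.eventually_ge_atTop (max X₀ 2),
    (tendsto_hbEta hc).eventually (eventually_le_nhds (by norm_num : (0 : ℝ) < 1 / 10)),
    eventually_sqrt_hbX_le c, eventually_hbSide_le_two_mul c, eventually_hbSide_le_div_six hc,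
    (tendsto_hbBoxSide_atTop c).eventually_ge_atTop 1] with N hN hX hη hsq hS2 hS6 hS1
  have hX1 : 1 < hbX N := by linarith [le_max_right X₀ 2]
  have hη0 : 0 < hbEta c N := by
    unfold hbEta; exact Real.rpow_pos_of_pos (Real.log_pos hX1) _
  have hS2' : (hbSide c N : ℝ) ≤ 2 * (hbEta c N * hbX N) := by
    have e : 2 * hbX N * hbEta c N = 2 * (hbEta c N * hbX N) := by ring
    rw [← e]; exact hS2
  have hS1' : 1 ≤ hbSide c N := by
    have : (1 : ℝ) ≤ (hbSide c N : ℝ) := by rw [hbSide_def]; exact hS1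
    exact_mod_cast this
  exact ⟨hN, (le_max_left _ _).trans hX, hη0, hη, hsq, hS2', hbEta_mul_hbX_sub_one_le_hbSide hη0.le,
    hS6, hS1'⟩

end Summit.Parity.GeneralizedHardyLittlewood.Theorems.RomanoffHeathBrown

end
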